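import Literature.Probability.RandomPlanarGeometry.SAWKestenInequalityAbstract
import HarnessLib

/-!
# Kesten's ratio inequality from approximate transfer counts — without the growth hypothesis

Topic `Literature/Probability/RandomPlanarGeometry` (continues `SAWKestenInequalityAbstract.lean`:
`SAW.kesten_ineq_of_transfer`, the pointwise estimate `SAW.xi_shifted_le`, `SAW.sq_sum_le_card_mul_sum_sq'`).
Source: N. Madras, G. Slade, *The Self-Avoiding Walk* (1993), §7.3, proof of Theorem 7.3.2, pp. 244–247,
eqs. (7.3.5)–(7.3.12), and the Remark on p. 244 (one-step version on the triangular lattice).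

The tree's `kesten_ineq_of_transfer` assumes, besides the transfer estimates (P1), (P2), the density (P3) and
`I ≤ c₄ N`, the GROWTH hypothesis (H) `#S_{N+1} ≤ B · #S_N` with a constant `B`.  For the family of all walks
this is submultiplicativity; for BRIDGES (Madras–Slade Theorem 7.3.4(d): `b_{N+1}/b_N → μ`) no a-priori constant
is available before the ratio limit theorem itself.  This file removes (H): it is implied, in the weak form
`#S_{N+1} ≤ 2 c₄ N · #S_N` for `N` large, by (P1) (`#{ω' : J(ω') ≥ 1} ≤ Σ_ω I(ω) ≤ c₄ N · #S_N`) and (P3) at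
`N + 1` (`#{ω' : J(ω') = 0} ≤ C · #S_{N+1}/(N+1)³ ≤ #S_{N+1}/2`), and the cubic decay in (P3) absorbs the extra
factor `N²` in the only place where (H) was used (`2 · #S_{N+1} · #{J = 0} ≤ 8 C c₄² · #S_N²/N`).  The constant
becomes `D = K + K₂ C + 8 C c₄²` in place of `K + K₂ C + 2 C B²`.

## Main statement (namespace `Literature.Probability.RandomPlanarGeometry.SAW`)

* **`kesten_ineq_of_transfer_noGrowth`** — `kesten_ineq_of_transfer` with the hypotheses `hB`, `hφ` deleted
  and nothing added: `∃ D, ∀ᶠ N, φ_N² − D/N ≤ φ_N φ_{N+1}`, `φ_N = #S_{N+1}/#S_N`.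
-/

noncomputable section

open Finset Filter Topology

namespace Literature.Probability.RandomPlanarGeometry.SAW

/-- **Kesten's inequality from approximate transfer counts, no growth hypothesis.** For finite sets `S N`,
site counts `I N ≤ c₄ N` and `J N`, suppose for all `N ≥ N₁`: `0 < #S N`;
(P1) `#{ω' ∈ S (N+1) : 1 ≤ J ω'} ≤ Σ_{ω ∈ S N} I ω / max (J ω − c₁) 1`;
(P2) `Σ_{ω ∈ S N} I ω (I ω − c₂)/((J ω + c₃)(J ω + c₃ + 1)) ≤ #S (N+2)`;
(P3) `#{ω ∈ S N : J ω < aN} ≤ C·#S N/N³` for `N ≥ 1`.  Then there is `D` with `φ_N² − D/N ≤ φ_N φ_{N+1}` for all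
large `N`, `φ_N = #S (N+1)/#S N` — the growth bound `#S (N+1) ≤ 2c₄N · #S N` being a consequence of (P1) and (P3).
[cite: MadrasSlade1993, Theorem 7.3.2 (proof, (7.3.5)–(7.3.12)) and p. 244 Remark; Theorem 7.3.4(d) (bridges)] -/
theorem kesten_ineq_of_transfer_noGrowth {α : Type*} (S : ℕ → Finset α) (I J : ℕ → α → ℕ) (N₁ : ℕ)
    {a C c₁ c₂ c₃ c₄ : ℝ} (ha : 0 < a) (hC : 0 ≤ C) (hc₁ : 0 ≤ c₁) (hc₂ : 0 ≤ c₂)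
    (hc₃ : 1 ≤ c₃) (hc₄ : 0 ≤ c₄)
    (hS : ∀ N, N₁ ≤ N → 0 < #(S N))
    (hI : ∀ N, N₁ ≤ N → ∀ ω ∈ S N, (I N ω : ℝ) ≤ c₄ * N)
    (hP1 : ∀ N, N₁ ≤ N → (#((S (N + 1)).filter fun ω' => 1 ≤ J (N + 1) ω') : ℝ) ≤
      ∑ ω ∈ S N, (I N ω : ℝ) / max ((J N ω : ℝ) - c₁) 1)
    (hP2 : ∀ N, N₁ ≤ N → ∑ ω ∈ S N, (I N ω : ℝ) * ((I N ω : ℝ) - c₂) /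
        (((J N ω : ℝ) + c₃) * ((J N ω : ℝ) + c₃ + 1)) ≤ (#(S (N + 2)) : ℝ))
    (hP3 : ∀ N, N₁ ≤ N → 1 ≤ N →
      (#((S N).filter fun ω => (J N ω : ℝ) < a * N) : ℝ) ≤ C * #(S N) / (N : ℝ) ^ 3) :
    ∃ D : ℝ, ∀ᶠ N : ℕ in atTop,
      ((#(S (N + 1)) : ℝ) / #(S N)) ^ 2 - D / N ≤
        ((#(S (N + 1)) : ℝ) / #(S N)) * ((#(S (N + 2)) : ℝ) / #(S (N + 1))) := by
  -- the constants
  set K : ℝ := 4 * c₄ ^ 2 * (2 * c₃ + 2 * c₁ + 1 + c₃ ^ 2 + c₃) / a ^ 3 + c₂ * c₄ / a ^ 2 with hK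
  set K₂ : ℝ := c₄ ^ 2 + c₂ * c₄ with hK₂
  have hK0 : 0 ≤ K := by positivity
  have hK₂0 : 0 ≤ K₂ := by positivity
  refine ⟨K + K₂ * C + 8 * C * c₄ ^ 2, ?_⟩
  -- `N` large: `N ≥ 1`, `N ≥ N₁`, `aN ≥ 2c₁ + 2` and `2C ≤ N`
  have hev : ∀ᶠ N : ℕ in atTop, 2 * c₁ + 2 ≤ a * N := by
    have := tendsto_natCast_atTop_atTop (R := ℝ) |>.const_mul_atTop ha
    exact this.eventually_ge_atTop _
  have hevC : ∀ᶠ N : ℕ in atTop, 2 * C ≤ (N : ℝ) :=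
    (tendsto_natCast_atTop_atTop (R := ℝ)).eventually_ge_atTop _
  filter_upwards [eventually_ge_atTop 1, eventually_ge_atTop N₁, hev, hevC] with N hN hN₁ haN hCN
  have hN1 : (1 : ℝ) ≤ N := by exact_mod_cast hN
  have hN0 : (0 : ℝ) < N := by linarith
  -- notation
  have hW0 : (0 : ℝ) < #(S N) := by exact_mod_cast hS N hN₁
  have hW1 : (0 : ℝ) < #(S (N + 1)) := by exact_mod_cast hS (N + 1) (by omega)
  set W₀ : ℝ := (#(S N) : ℝ) with hW₀
  set W₁ : ℝ := (#(S (N + 1)) : ℝ) with hW₁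
  set W₂ : ℝ := (#(S (N + 2)) : ℝ) with hW₂
  -- Step 1: split `S (N+1)` by `J ≥ 1` / `J = 0`; the latter part is rare by (P3) at `N + 1`
  set W₁p : ℝ := (#((S (N + 1)).filter fun ω' => 1 ≤ J (N + 1) ω') : ℝ) with hW₁p
  set W₁z : ℝ := (#((S (N + 1)).filter fun ω' => ¬ 1 ≤ J (N + 1) ω') : ℝ) with hW₁z
  have hsplit : W₁ = W₁p + W₁z := by
    rw [hW₁, hW₁p, hW₁z]
    exact_mod_cast (Finset.card_filter_add_card_filter_not (s := S (N + 1))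
      (p := fun ω' => 1 ≤ J (N + 1) ω')).symm
  -- the cube `T = (N+1)³ ≥ N³ ≥ N`, and `2C ≤ N`
  have hT3 : (N : ℝ) ^ 3 ≤ ((N + 1 : ℕ) : ℝ) ^ 3 := by
    have : (N : ℝ) ≤ ((N + 1 : ℕ) : ℝ) := by exact_mod_cast Nat.le_succ N
    exact pow_le_pow_left₀ hN0.le this 3
  have hT1 : (N : ℝ) ≤ ((N + 1 : ℕ) : ℝ) ^ 3 := by
    have h : (N : ℝ) ≤ (N : ℝ) ^ 3 := by
      calc (N : ℝ) = (N : ℝ) ^ 1 := (pow_one _).symm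
        _ ≤ (N : ℝ) ^ 3 := pow_le_pow_right₀ hN1 (by norm_num)
    exact h.trans hT3
  set T : ℝ := ((N + 1 : ℕ) : ℝ) ^ 3 with hTdef
  have hT0 : 0 < T := lt_of_lt_of_le hN0 hT1
  have hW₁z_le : W₁z ≤ C * W₁ / T := by
    have h1 : W₁z ≤ #((S (N + 1)).filter fun ω => (J (N + 1) ω : ℝ) < a * ((N + 1 : ℕ) : ℝ)) := by
      rw [hW₁z]
      exact_mod_cast card_le_card (fun ω hω => by
        rw [mem_filter] at hω ⊢
        refine ⟨hω.1, ?_⟩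
        have : J (N + 1) ω = 0 := by omega
        rw [this, Nat.cast_zero]; positivity)
    exact h1.trans (hP3 (N + 1) (by omega) (by omega))
  have hW₁z0 : 0 ≤ W₁z := by positivity
  have hW₁p0 : 0 ≤ W₁p := by positivity
  have hW₁z_half : W₁z ≤ W₁ / 2 := by
    have h1 : C * W₁ / T ≤ C * W₁ / N := div_le_div_of_nonneg_left (by positivity) hN0 hT1
    have h2 : C * W₁ / N ≤ W₁ / 2 := by
      rw [div_le_div_iff₀ hN0 (by norm_num : (0 : ℝ) < 2)]
      calc C * W₁ * 2 = (2 * C) * W₁ := by ring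
        _ ≤ (N : ℝ) * W₁ := mul_le_mul_of_nonneg_right hCN hW1.le
        _ = W₁ * N := by ring
    exact hW₁z_le.trans (h1.trans h2)
  -- Step 1': the growth bound `W₁ ≤ 2 c₄ N W₀` from (P1) and (P3)
  set f : α → ℝ := fun ω => (I N ω : ℝ) / max ((J N ω : ℝ) - c₁) 1 with hf
  have hf_le : ∀ ω ∈ S N, f ω ≤ c₄ * N := by
    intro ω hω
    have hI0 : (0 : ℝ) ≤ I N ω := Nat.cast_nonneg _
    have hm1 : (1 : ℝ) ≤ max ((J N ω : ℝ) - c₁) 1 := le_max_right _ _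
    calc f ω ≤ (I N ω : ℝ) / 1 := div_le_div_of_nonneg_left hI0 one_pos hm1
      _ = I N ω := div_one _
      _ ≤ c₄ * N := hI N hN₁ ω hω
  have hW₁p_le : W₁p ≤ c₄ * N * W₀ := by
    calc W₁p ≤ ∑ ω ∈ S N, f ω := hP1 N hN₁
      _ ≤ ∑ ω ∈ S N, c₄ * N := sum_le_sum hf_le
      _ = c₄ * N * W₀ := by rw [sum_const, nsmul_eq_mul, hW₀]; ring
  have hgrowth : W₁ ≤ 2 * c₄ * N * W₀ := by
    rw [hsplit] at hW₁z_half ⊢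
    linarith
  -- Step 2: `W₁² ≤ W₁p² + 2 W₁ W₁z ≤ W₁p² + 8 C c₄² W₀²/N`
  have hsq : W₁ ^ 2 ≤ W₁p ^ 2 + 8 * C * c₄ ^ 2 * W₀ ^ 2 / N := by
    have h1 : W₁ ^ 2 ≤ W₁p ^ 2 + 2 * W₁ * W₁z := by rw [hsplit]; nlinarith
    have h2 : 2 * W₁ * W₁z ≤ 2 * W₁ * (C * W₁ / T) := mul_le_mul_of_nonneg_left hW₁z_le (by positivity)
    have hsq1 : W₁ * W₁ ≤ (2 * c₄ * N * W₀) * (2 * c₄ * N * W₀) :=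
      mul_le_mul hgrowth hgrowth hW1.le (by positivity)
    have h7 : (N : ℝ) ^ 2 / T ≤ 1 / N := by
      rw [div_le_div_iff₀ hT0 hN0, one_mul]
      calc (N : ℝ) ^ 2 * N = (N : ℝ) ^ 3 := by ring
        _ ≤ T := hT3
    have h3 : 2 * W₁ * (C * W₁ / T) ≤ 8 * C * c₄ ^ 2 * W₀ ^ 2 / N := by
      calc 2 * W₁ * (C * W₁ / T) = (2 * C / T) * (W₁ * W₁) := by ring
        _ ≤ (2 * C / T) * ((2 * c₄ * N * W₀) * (2 * c₄ * N * W₀)) :=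
            mul_le_mul_of_nonneg_left hsq1 (by positivity)
        _ = (8 * C * c₄ ^ 2 * W₀ ^ 2) * ((N : ℝ) ^ 2 / T) := by ring
        _ ≤ (8 * C * c₄ ^ 2 * W₀ ^ 2) * (1 / N) := mul_le_mul_of_nonneg_left h7 (by positivity)
        _ = 8 * C * c₄ ^ 2 * W₀ ^ 2 / N := by ring
    linarith
  -- Step 3: Schwarz on (P1)
  have hCS : W₁p ^ 2 ≤ W₀ * ∑ ω ∈ S N, f ω ^ 2 := by
    have h1 : W₁p ≤ ∑ ω ∈ S N, f ω := hP1 N hN₁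
    calc W₁p ^ 2 ≤ (∑ ω ∈ S N, f ω) ^ 2 := pow_le_pow_left₀ hW₁p0 h1 2
      _ ≤ W₀ * ∑ ω ∈ S N, f ω ^ 2 := sq_sum_le_card_mul_sum_sq' _ _
  -- Step 4: (P2)
  set g : α → ℝ := fun ω => (I N ω : ℝ) * ((I N ω : ℝ) - c₂) /
    (((J N ω : ℝ) + c₃) * ((J N ω : ℝ) + c₃ + 1)) with hg
  have hP2N : ∑ ω ∈ S N, g ω ≤ W₂ := hP2 N hN₁
  -- pointwise `Ξ` bound and its sum
  have hpt : ∀ ω ∈ S N, f ω ^ 2 - g ω ≤ K / N + K₂ * (N : ℝ) ^ 2 * (if (J N ω : ℝ) < a * N then 1 else 0) := by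
    intro ω hω
    exact xi_shifted_le ha hc₁ hc₂ hc₃ hc₄ hN haN (Nat.cast_nonneg _) (hI N hN₁ ω hω) (Nat.cast_nonneg _)
  have hsum : ∑ ω ∈ S N, (f ω ^ 2 - g ω) ≤ (K + K₂ * C) * W₀ / N := by
    have hP3N := hP3 N hN₁ hN
    rw [← hW₀] at hP3N
    have hstep1 : ∑ ω ∈ S N, (f ω ^ 2 - g ω) ≤
        ∑ ω ∈ S N, (K / N + K₂ * (N : ℝ) ^ 2 * (if (J N ω : ℝ) < a * N then 1 else 0)) := sum_le_sum hpt
    have hstep2 : ∑ ω ∈ S N, (K / N + K₂ * (N : ℝ) ^ 2 * (if (J N ω : ℝ) < a * N then 1 else 0)) =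
        W₀ * (K / N) + K₂ * (N : ℝ) ^ 2 * (#((S N).filter fun ω => (J N ω : ℝ) < a * N) : ℝ) := by
      rw [sum_add_distrib, sum_const, nsmul_eq_mul, ← mul_sum, sum_boole, hW₀]
    have hstep3 : K₂ * (N : ℝ) ^ 2 * (#((S N).filter fun ω => (J N ω : ℝ) < a * N) : ℝ) ≤
        K₂ * (N : ℝ) ^ 2 * (C * W₀ / (N : ℝ) ^ 3) :=
      mul_le_mul_of_nonneg_left hP3N (by positivity)
    have e : W₀ * (K / N) + K₂ * (N : ℝ) ^ 2 * (C * W₀ / (N : ℝ) ^ 3) = (K + K₂ * C) * W₀ / N := by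
      field_simp
    rw [← e]
    exact hstep1.trans (hstep2.le.trans (by linarith))
  -- assemble: `W₁² − D W₀²/N ≤ W₀ W₂`
  have hmain : W₁ ^ 2 - (K + K₂ * C + 8 * C * c₄ ^ 2) * W₀ ^ 2 / N ≤ W₀ * W₂ := by
    have h1 : W₀ * ∑ ω ∈ S N, f ω ^ 2 - W₀ * ∑ ω ∈ S N, g ω ≤ (K + K₂ * C) * W₀ ^ 2 / N := by
      rw [← mul_sub, ← sum_sub_distrib]
      have := mul_le_mul_of_nonneg_left hsum hW0.le
      calc W₀ * ∑ ω ∈ S N, (f ω ^ 2 - g ω) ≤ W₀ * ((K + K₂ * C) * W₀ / N) := this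
        _ = (K + K₂ * C) * W₀ ^ 2 / N := by ring
    have h2 : W₀ * ∑ ω ∈ S N, g ω ≤ W₀ * W₂ := mul_le_mul_of_nonneg_left hP2N hW0.le
    have e : (K + K₂ * C + 8 * C * c₄ ^ 2) * W₀ ^ 2 / N =
        (K + K₂ * C) * W₀ ^ 2 / N + 8 * C * c₄ ^ 2 * W₀ ^ 2 / N := by ring
    rw [e]
    linarith
  -- divide by `W₀²`
  set D : ℝ := K + K₂ * C + 8 * C * c₄ ^ 2 with hD
  have h3 : (W₁ ^ 2 - D * W₀ ^ 2 / N) / W₀ ^ 2 ≤ (W₀ * W₂) / W₀ ^ 2 :=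
    div_le_div_of_nonneg_right hmain (by positivity)
  have e3 : (W₁ ^ 2 - D * W₀ ^ 2 / N) / W₀ ^ 2 = (W₁ / W₀) ^ 2 - D / N := by
    field_simp
  have e4 : (W₀ * W₂) / W₀ ^ 2 = W₁ / W₀ * (W₂ / W₁) := by
    field_simp
  rw [e3, e4] at h3
  exact h3

end Literature.Probability.RandomPlanarGeometry.SAW
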